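import Summits.BirchSwinnertonDyer.BirchSwinnertonDyer.Theorems.ByReductionTypeAtTwoOrdKatoHalfAtTwoIsoZetaColemanMuDefs
import HarnessLib

/-!
# Route ByReductionTypeAtTwo, crux `OrdKatoHalfAtTwoIso` (stmt-BirchSwinnertonDyer-19573), line
# `steinberg-fibre-at-two`: the door with the RE-CUT socket 2 and B8 restricted to `Δ > 0`

Seat `cruxlead-stmt-BirchSwinnertonDyer-19573-g4` (LEAD PROVER, MODE LINE; HOME `run/shared/lean/pub/bsd-2adic/`;
`--supports` stmt-BirchSwinnertonDyer-23762 `OrdKatoIntSurjectiveAtTwo`). HONEST FRAMING (cell bsd-2adic): BSD is not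
proved by any of this and the crux `OrdKatoHalfAtTwoIso` is NOT proved here; both theorems are CONDITIONAL doors on
displayed memo/cite binders. What they add to `…ZetaColemanMuDefs.lean` (p678187): since the re-cut socket 2
`ZetaColemanMuInputsNegDiscAtTwo` already yields Kato's lower divisibility AT every good-ordinary curve with `ρ̄_{W,2}` onto
and `Δ_W < 0` (`mainConjectureLowerDivisibilityAtTwoOrd_of_zetaColemanMuInputsNegDiscAtTwo`), the big-image binder B8 is
needed only on `Δ_W > 0` — the habitat of the cell memo MEMO-6 (`c_∞ = 2` removal) — and no longer on `Δ_W < 0` (reserve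
wall W_K2 Thm. B). The hypothesis `hB8pos` below is the proposed RE-TYPED text of child stmt-BirchSwinnertonDyer-23762
(`KatoIntAtGoodOrdSurjectiveTwo` guarded by `0 < W.Δ`); it is displayed inline because no constant with that text exists
yet (the planner's call), and it is implied by the filed B8 trivially (`katoIntPosDisc_of_katoInt`).

* `katoIntPosDisc_of_katoInt` — the filed B8 implies its `Δ > 0` restriction (so the new door is at least as good).
* `exists_isIsogenous_mainConjectureLowerDivisibilityAtTwoOrd_of_zetaColemanMu_posDisc` — at every non-CM good-ordinary
  `W`: `ρ̄₂` not onto ↦ B7 at the Kato-optimal member; `ρ̄₂` onto ∧ `Δ < 0` ↦ the re-cut socket (+ Abbes–Ullmo + Kato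
  17.4 (1)(2)); `ρ̄₂` onto ∧ `Δ > 0` ↦ `ρ_{2^∞}` onto by Dokchitser–Dokchitser (`Δ_neg_of_residue'` contraposed), then
  `hB8pos`. (`Δ ≠ 0`: `W.isUnit_Δ`.)
* `ordKatoHalfAtTwoIso_of_zetaColemanMu_posDisc` — **the crux BY NAME** from the re-cut socket, Abbes–Ullmo, B7, B8 on
  `Δ > 0` only, and Kato 17.4 (1)(2) at `2`.

References: [Kato2004Asterisque] Thm 17.4 (p. 273), §17.13 (pp. 279–280); [AbbesUllmo1996] Thm A;
[DokchitserDokchitserMathZ2012]; MEMO-5′ / MEMO-6 / W_K2 (HOME); `…ZetaColemanMuDefs.lean` (p678187).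
-/

set_option autoImplicit false
set_option linter.dupNamespace false

noncomputable section

open scoped Classical MatrixGroups ModularForm NumberField
open CongruenceSubgroup WeierstrassCurve Field IsDedekindDomain
open Literature.NumberTheory.GaloisRepresentations
open Literature.NumberTheory.EllipticCurves Literature.NumberTheory.EllipticCurves.ModularForms
open Literature.NumberTheory.EllipticCurves.Kato2004
open Literature.NumberTheory.EllipticCurves.Rank1Residual
open Summit.BirchSwinnertonDyer.Rank1Residual Summit.BirchSwinnertonDyer.Rank1Residual.X5
open Summit.BirchSwinnertonDyer.BirchSwinnertonDyer.Theorems.OrdKatoOptimalAtTwo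
  Summit.BirchSwinnertonDyer.BirchSwinnertonDyer.Theorems.OrdKatoIntAtTwo
open Summit.BirchSwinnertonDyer.BirchSwinnertonDyer.Theses.ByReductionTypeAtTwo

namespace Summit.BirchSwinnertonDyer.BirchSwinnertonDyer.Theorems.SteinbergFibreAtTwo

/-- **The filed B8 implies its `Δ > 0` restriction** (drop the sign hypothesis). [folklore] -/
theorem katoIntPosDisc_of_katoInt (hB8 : KatoIntAtGoodOrdSurjectiveTwo) :
    ∀ (W : WeierstrassCurve ℚ) [W.IsElliptic] [W.IsGloballyMinimal],
      GoodOrd W 2 → O1.TwoAdicSurjective W → 0 < W.Δ → O1.MainConjectureLowerDivisibilityAtTwoOrd W :=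
  fun W _ _ hgo him _ => hB8 W hgo him

/-- **The `∃`-member form at EVERY non-CM good-ordinary curve from the re-cut socket, Abbes–Ullmo BY NAME, B7, B8 on
`Δ > 0` only, and Kato 17.4 (1)(2) at `2` (`h17`).** Cases: `ρ̄_{W,2}` not onto — B7 at the Kato-optimal member
(`exists_isIsogenous_mainConjectureLowerDivisibilityAtTwoOrd_of_binder`); `ρ̄_{W,2}` onto and `Δ_W < 0` — the re-cut
socket at `W` itself (`mainConjectureLowerDivisibilityAtTwoOrd_of_zetaColemanMuInputsNegDiscAtTwo`); `ρ̄_{W,2}` onto and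
`Δ_W > 0` — then `ρ_{W,2^∞}` is onto (else Dokchitser–Dokchitser forces `Δ_W < 0`, `Δ_neg_of_residue'`), so `hB8pos`
at `W` itself. Conditional; nothing asserted. [cite: Kato2004Asterisque, Thm. 17.4 (1)(2) (p. 273)]
[cite: DokchitserDokchitserMathZ2012, Theorem (p. 961)] -/
theorem exists_isIsogenous_mainConjectureLowerDivisibilityAtTwoOrd_of_zetaColemanMu_posDisc
    (hF : ZetaColemanMuInputsNegDiscAtTwo) (hAU : abbesUllmo_not_dvd_maninConstant_of_not_dvd_level)
    (hB7 : KatoMuPartAtOptimalMemberOfNotSurjectiveTwo)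
    (hB8pos : ∀ (W : WeierstrassCurve ℚ) [W.IsElliptic] [W.IsGloballyMinimal],
      GoodOrd W 2 → O1.TwoAdicSurjective W → 0 < W.Δ → O1.MainConjectureLowerDivisibilityAtTwoOrd W)
    (h17 : ∀ (V : WeierstrassCurve ℚ) [V.IsElliptic] [V.IsGloballyMinimal] [NeZero (V.conductorNorm ℤ)]
      (f : CuspForm (Gamma0 (V.conductorNorm ℤ)) 2), kato_divisibility_allPrimes V 2 (f := f))
    (W : WeierstrassCurve ℚ) [W.IsElliptic] [W.IsGloballyMinimal] (hcm : ¬ W.HasCM) (hgo : GoodOrd W 2) :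
    ∃ (W' : WeierstrassCurve ℚ) (_ : W'.IsElliptic) (_ : W'.IsGloballyMinimal),
      IsIsogenous W W' ∧ O1.MainConjectureLowerDivisibilityAtTwoOrd W' := by
  by_cases him : W.HasSurjectiveModNGaloisRep 2
  · refine ⟨W, ‹_›, ‹_›, isIsogenous_self W, ?_⟩
    rcases lt_or_gt_of_ne W.isUnit_Δ.ne_zero with hΔ | hΔ
    · exact mainConjectureLowerDivisibilityAtTwoOrd_of_zetaColemanMuInputsNegDiscAtTwo W hF hAU hgo him hΔ (h17 W)
    · have hinf : O1.TwoAdicSurjective W := by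
        by_contra hns
        exact lt_asymm hΔ (Δ_neg_of_residue' W hgo him hns)
      exact hB8pos W hgo hinf hΔ
  · exact exists_isIsogenous_mainConjectureLowerDivisibilityAtTwoOrd_of_binder W hB7 h17 hcm hgo him

/-- **The crux `OrdKatoHalfAtTwoIso` (stmt-BirchSwinnertonDyer-19573) BY NAME from the re-cut socket 2, Abbes–Ullmo,
B7, B8 restricted to `Δ > 0`, and Kato 17.4 (1)(2) at `2`** (the crux's `analyticRank = 0` is not used). Conditional on
the displayed binders; nothing closed. [cite: Kato2004Asterisque, Thm. 17.4 (1)(2) (p. 273)] [cite: AbbesUllmo1996, Thm. A] -/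
theorem ordKatoHalfAtTwoIso_of_zetaColemanMu_posDisc
    (hF : ZetaColemanMuInputsNegDiscAtTwo) (hAU : abbesUllmo_not_dvd_maninConstant_of_not_dvd_level)
    (hB7 : KatoMuPartAtOptimalMemberOfNotSurjectiveTwo)
    (hB8pos : ∀ (W : WeierstrassCurve ℚ) [W.IsElliptic] [W.IsGloballyMinimal],
      GoodOrd W 2 → O1.TwoAdicSurjective W → 0 < W.Δ → O1.MainConjectureLowerDivisibilityAtTwoOrd W)
    (h17 : ∀ (V : WeierstrassCurve ℚ) [V.IsElliptic] [V.IsGloballyMinimal] [NeZero (V.conductorNorm ℤ)]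
      (f : CuspForm (Gamma0 (V.conductorNorm ℤ)) 2), kato_divisibility_allPrimes V 2 (f := f)) :
    OrdKatoHalfAtTwoIso :=
  fun W _ _ hcm _ hgo =>
    exists_isIsogenous_mainConjectureLowerDivisibilityAtTwoOrd_of_zetaColemanMu_posDisc hF hAU hB7 hB8pos h17 W hcm hgo

end Summit.BirchSwinnertonDyer.BirchSwinnertonDyer.Theorems.SteinbergFibreAtTwo

end
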